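import Summits.MatrixMultiplication.MatrixMultiplication.Theorems.FarEdgeDescentTailFreedom
import HarnessLib

/-!
# FarEdgeDescent — FAR-TAIL FREEDOM (II): the fold shadow is admissible, hence realised

Continuation of `FarEdgeDescentTailFreedom` (same hypotheses, same def-free conventions).  For a far excess
`e : [1,∞) → ℝ` that is convex, antitone, nonnegative and cube-line coupled
(`e(1) − e(x) ≤ ((1 − e(1))/3)·(x − 1)`), the FOLD SHADOW profile
`F(x) = x + 1 + e(x)` (`x ≥ 1`), `F(t) = max(2, (3+t)/2 + ((1+t)/2)·e(2/(1+t)))` (`t < 1`)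
satisfies the six hypotheses of `perspectiveWorld_realises` (convex, monotone, `1`-Lipschitz, floors, ceiling,
FOLD) — `foldShadow_admissible` — so its perspective world is a 3D-LAWFUL functional with far pencil EXACTLY
`x + 1 + e(x)` and `ω_W = 2 + e(1)` (`foldShadow_realises`, `farTail_realisable`).  In each of the three places
where near and far sides meet (convex gluing at the square, the far fold, the near Lipschitz bound) the budget
is exactly the cube-line identity `e(1) + 3·((1 − e(1))/3) = 1`: the coupling is sharp and it is the ONLY one.
-/

set_option linter.dupNamespace false

noncomputable section

namespace Summit.MatrixMultiplication.MatrixMultiplication.Theorems.FarEdgeDescentTailShadow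

open Literature.Computability.AlgebraicComplexity Set
open Summit.MatrixMultiplication.MatrixMultiplication.Theorems.FarEdgeDescentPencilRealisability
open Summit.MatrixMultiplication.MatrixMultiplication.Theorems.FarEdgeDescentTailFreedom

section FoldShadow

variable {e F : ℝ → ℝ}
  (hconv : ConvexOn ℝ (Ici 1) e) (hanti : AntitoneOn e (Ici 1)) (hnn : ∀ x : ℝ, 1 ≤ x → 0 ≤ e x)
  (hcube : ∀ x : ℝ, 1 ≤ x → e 1 - e x ≤ (1 - e 1) / 3 * (x - 1))
  (hF : ∀ x : ℝ, F x = if 1 ≤ x then x + 1 + e x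
    else max 2 ((3 + x) / 2 + (1 + x) / 2 * e (2 / (1 + x))))

include hconv hanti hnn hcube hF

/-- ADMISSIBILITY (i): the fold shadow is convex on `[0,∞)` — near piece and far piece are convex and the
cross secant condition at the square is exactly the cube-line coupling `e(1) + 3s ≤ 1`. -/
theorem foldShadow_convex : ConvexOn ℝ (Ici 0) F := by
  have h1e := e_one_le_one hanti hcube
  refine convexOn_Ici_of_glue zero_le_one ?_ ?_ ?_
  · exact (shadow_convex hconv).congr fun x hx => (F_near hnn hF hx.2).symm
  · refine ⟨convex_Ici 1, fun x hx y hy a b ha hb hab => ?_⟩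
    have h := hconv.2 hx hy ha hb hab
    have hx' : 1 ≤ x := hx
    have hy' : 1 ≤ y := hy
    have hz : (1 : ℝ) ≤ a • x + b • y := by
      simp only [smul_eq_mul]; nlinarith
    rw [F_far hF hz, F_far hF hx', F_far hF hy']
    simp only [smul_eq_mul] at h ⊢
    nlinarith [h]
  · intro x z hx0 hx1 hz1
    obtain ⟨hw1, hw2, hwid⟩ := near_arg hx0 hx1.le
    have hcw := hcube (2 / (1 + x)) hw1
    have hcz := hcube z hz1.le
    have hFx : (3 + x) / 2 + (1 + x) / 2 * e (2 / (1 + x)) ≤ F x := by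
      rw [F_near hnn hF hx1.le]; exact le_max_right _ _
    have hF1 : F 1 = 2 + e 1 := by rw [F_far hF le_rfl]; ring
    have hFz : F z = z + 1 + e z := F_far hF hz1.le
    have hlow : (1 + x) / 2 * (e 1 - (1 - e 1) / 3 * (2 / (1 + x) - 1)) ≤
        (1 + x) / 2 * e (2 / (1 + x)) := mul_le_mul_of_nonneg_left (by linarith) (by linarith)
    have hid : (1 + x) / 2 * ((1 - e 1) / 3 * (2 / (1 + x) - 1)) = (1 - e 1) / 3 * (1 - x) / 2 := by
      rw [← hwid]; ring
    have hb1 : F 1 - F x ≤ (1 - x) / 2 * (1 + e 1 + (1 - e 1) / 3) := by nlinarith [hlow, hid, hFx, hF1]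
    have hb2 : (z - 1) * (1 - (1 - e 1) / 3) ≤ F z - F 1 := by rw [hFz, hF1]; nlinarith [hcz]
    have hzx : 0 ≤ (z - 1) * (1 - x) := mul_nonneg (by linarith) (by linarith)
    have k1 := mul_le_mul_of_nonneg_right hb1 (show 0 ≤ z - 1 by linarith)
    have k2 := mul_le_mul_of_nonneg_right hb2 (show 0 ≤ 1 - x by linarith)
    nlinarith [k1, k2, hzx]

/-- ADMISSIBILITY (ii): the fold shadow is monotone on `[0,∞)`. -/
theorem foldShadow_monotone : MonotoneOn F (Ici 0) := by
  have h1e := e_one_le_one hanti hcube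
  have h0 := hnn 1 le_rfl
  have far : ∀ x y : ℝ, 1 ≤ x → x ≤ y → F x ≤ F y := by
    intro x y hx hxy
    rw [F_far hF hx, F_far hF (hx.trans hxy)]
    have := secant_le hconv hcube hx hxy
    nlinarith
  have near1 : ∀ x : ℝ, 0 ≤ x → x ≤ 1 → F x ≤ F 1 := by
    intro x hx0 hx1
    rw [F_near hnn hF hx1, F_far hF le_rfl]
    refine max_le (by linarith) ?_
    have := shadow_le_e_one hanti hx0 hx1
    nlinarith
  intro x hx y hy hxy
  have hx0 : 0 ≤ x := hx
  rcases le_or_gt y 1 with hy1 | hy1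
  · rw [F_near hnn hF (hxy.trans hy1), F_near hnn hF hy1]
    exact max_le_max le_rfl (shadow_mono hanti hnn hx0 hxy hy1)
  rcases le_or_gt 1 x with hx1 | hx1
  · exact far x y hx1 hxy
  · exact (near1 x hx0 hx1.le).trans (far 1 y le_rfl hy1.le)

/-- ADMISSIBILITY (iii): the fold shadow is `1`-Lipschitz on `[0,∞)`. -/
theorem foldShadow_lipschitz : ∀ x y : ℝ, 0 ≤ x → x ≤ y → F y - F x ≤ y - x := by
  have near : ∀ x y : ℝ, 0 ≤ x → x ≤ y → y ≤ 1 → F y - F x ≤ y - x := by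
    intro x y hx0 hxy hy1
    rw [F_near hnn hF (hxy.trans hy1), F_near hnn hF hy1]
    have h := shadow_lip hconv hanti hcube hx0 hxy hy1
    have hm : max 2 ((3 + y) / 2 + (1 + y) / 2 * e (2 / (1 + y))) ≤
        max 2 ((3 + x) / 2 + (1 + x) / 2 * e (2 / (1 + x))) + (y - x) :=
      max_le (by linarith [le_max_left (2:ℝ) ((3 + x) / 2 + (1 + x) / 2 * e (2 / (1 + x)))])
        (by linarith [le_max_right (2:ℝ) ((3 + x) / 2 + (1 + x) / 2 * e (2 / (1 + x)))])
    linarith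
  have far : ∀ x y : ℝ, 1 ≤ x → x ≤ y → F y - F x ≤ y - x := by
    intro x y hx hxy
    rw [F_far hF hx, F_far hF (hx.trans hxy)]
    have := hanti (mem_Ici.2 hx) (mem_Ici.2 (hx.trans hxy)) hxy
    linarith
  intro x y hx0 hxy
  rcases le_or_gt y 1 with hy1 | hy1
  · exact near x y hx0 hxy hy1
  rcases le_or_gt 1 x with hx1 | hx1
  · exact far x y hx1 hxy
  · have a := near x 1 hx0 hx1.le le_rfl
    have b := far 1 y le_rfl hy1.le
    linarith

omit hconv in
/-- ADMISSIBILITY (iv)+(v): floors `max(2, x+1) ≤ F` and ceiling `F ≤ x+2` on `[0,∞)`. -/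
theorem foldShadow_sandwich :
    (∀ x : ℝ, 0 ≤ x → max 2 (x + 1) ≤ F x) ∧ (∀ x : ℝ, 0 ≤ x → F x ≤ x + 2) := by
  have h1e := e_one_le_one hanti hcube
  refine ⟨fun x hx => ?_, fun x hx => ?_⟩
  · rcases le_or_gt x 1 with hx1 | hx1
    · rw [F_near hnn hF hx1]
      exact max_le (le_max_left _ _) ((by linarith : x + 1 ≤ (2:ℝ)).trans (le_max_left _ _))
    · rw [F_far hF hx1.le]
      have := hnn x hx1.le
      exact max_le (by linarith) (by linarith)
  · rcases le_or_gt x 1 with hx1 | hx1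
    · rw [F_near hnn hF hx1]
      refine max_le (by linarith) ?_
      have := shadow_le_e_one hanti hx hx1
      nlinarith
    · rw [F_far hF hx1.le]
      have := hanti (mem_Ici.2 le_rfl) (mem_Ici.2 hx1.le) hx1.le
      linarith

omit hanti in
/-- ADMISSIBILITY (vi): the FOLD `(1+y)·F(2/(1+y)) ≤ 2·F(y)` for all `y > 0`.  For `y ≤ 1` it is the
definition of the shadow; for `y > 1` it is the chord of `e` on `[1,y]` at `w = 2(1+y)/(3+y)` plus the cube
line at `y` — again with equality budget exactly `e(1) + 3s = 1`. -/
theorem foldShadow_fold : ∀ y : ℝ, 0 < y → (1 + y) * F (2 / (1 + y)) ≤ 2 * F y := by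
  intro y hy
  have hpy : 0 < 1 + y := by linarith
  rcases le_or_gt y 1 with hy1 | hy1
  · -- near: F(y) ≥ shadow term = ((1+y)/2)·F(2/(1+y))
    obtain ⟨hv1, -, -⟩ := near_arg hy.le hy1
    rw [F_far hF hv1, F_near hnn hF hy1]
    have hid : (1 + y) * (2 / (1 + y) + 1 + e (2 / (1 + y))) =
        2 * ((3 + y) / 2 + (1 + y) / 2 * e (2 / (1 + y))) := by
      field_simp
      ring
    rw [hid]
    exact mul_le_mul_of_nonneg_left (le_max_right _ _) (by norm_num)
  · -- far: t = 2/(1+y) < 1, w = 2/(1+t) = 2(1+y)/(3+y) ∈ (1, y)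
    have ht1 : 2 / (1 + y) ≤ 1 := by rw [div_le_iff₀ hpy]; linarith
    have ht0 : 0 ≤ 2 / (1 + y) := by positivity
    rw [F_near hnn hF ht1, F_far hF hy1.le]
    set w := 2 / (1 + 2 / (1 + y)) with hw_def
    have hw : w * (3 + y) = 2 * (1 + y) := by
      rw [hw_def]
      field_simp
      ring
    have hw1 : 1 < w := by nlinarith
    have hwy : w < y := by nlinarith
    have chord := hconv.secant_mono_aux1 (x := 1) (y := w) (z := y) (mem_Ici.2 le_rfl)
      (mem_Ici.2 hy1.le) hw1 hwy
    have hid : (3 + y) * ((y - w) * e 1 + (w - 1) * e y) = (y - 1) * ((y + 2) * e 1 + e y) := by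
      linear_combination (e y - e 1) * hw
    have k : (y - 1) * ((3 + y) * e w) ≤ (y - 1) * ((y + 2) * e 1 + e y) := by
      rw [← hid]; nlinarith [chord]
    have k' : (3 + y) * e w ≤ (y + 2) * e 1 + e y := le_of_mul_le_mul_left k (by linarith)
    have hcy := hcube y hy1.le
    have h0 := hnn y hy1.le
    have ht : (1 + y) * (2 / (1 + y)) = 2 := by field_simp
    rw [mul_max_of_nonneg _ _ hpy.le]
    refine max_le (by nlinarith) ?_
    have hid2 : (1 + y) * ((3 + 2 / (1 + y)) / 2 + (1 + 2 / (1 + y)) / 2 * e w) =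
        (3 * y + 5) / 2 + (3 + y) / 2 * e w := by
      field_simp
      ring
    rw [hid2]
    nlinarith [k', hcy]

/-- ★ THE FOLD SHADOW IS ADMISSIBLE WITH THE FOLD: all six hypotheses of `perspectiveWorld_realises`. -/
theorem foldShadow_admissible :
    ConvexOn ℝ (Ici 0) F ∧ MonotoneOn F (Ici 0) ∧
    (∀ x y : ℝ, 0 ≤ x → x ≤ y → F y - F x ≤ y - x) ∧
    (∀ x : ℝ, 0 ≤ x → max 2 (x + 1) ≤ F x) ∧ (∀ x : ℝ, 0 ≤ x → F x ≤ x + 2) ∧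
    (∀ y : ℝ, 0 < y → (1 + y) * F (2 / (1 + y)) ≤ 2 * F y) :=
  ⟨foldShadow_convex hconv hanti hnn hcube hF, foldShadow_monotone hconv hanti hnn hcube hF,
    foldShadow_lipschitz hconv hanti hnn hcube hF, (foldShadow_sandwich hanti hnn hcube hF).1,
    (foldShadow_sandwich hanti hnn hcube hF).2, foldShadow_fold hconv hnn hcube hF⟩

/-- ★ SUFFICIENCY, realised: the perspective world of the fold shadow is a 3D-LAWFUL functional
(symmetric, homogeneous, subadditive, monotone, sandwiched on the open positive cone) whose far pencil is
EXACTLY the prescribed tail `x + 1 + e(x)` (`x ≥ 1`) and whose near pencil is the shadow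
`max(2, (3+x)/2 + ((1+x)/2)·e(2/(1+x)))` (`0 < x ≤ 1`); in particular `ω_W = W(1,1,1) = 2 + e(1)`. -/
theorem foldShadow_realises {W : ℝ → ℝ → ℝ → ℝ}
    (hW : ∀ a b c : ℝ, W a b c = max ((a + c) / 2 * F (2 * b / (a + c)))
      (max ((a + b) / 2 * F (2 * c / (a + b))) ((b + c) / 2 * F (2 * a / (b + c))))) :
    (∀ a b c : ℝ, W a b c = W b a c ∧ W a b c = W a c b) ∧
    (∀ ν : ℝ, 0 < ν → ∀ a b c : ℝ, 0 < a → 0 < b → 0 < c → W (ν * a) (ν * b) (ν * c) = ν * W a b c) ∧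
    (∀ a b c a' b' c' : ℝ, 0 < a → 0 < b → 0 < c → 0 < a' → 0 < b' → 0 < c' →
      W (a + a') (b + b') (c + c') ≤ W a b c + W a' b' c') ∧
    (∀ a b b' c : ℝ, 0 < a → 0 < b → b ≤ b' → 0 < c → W a b c ≤ W a b' c) ∧
    (∀ a b c : ℝ, 0 < a → 0 < b → 0 < c → max (a + c) (max (a + b) (b + c)) ≤ W a b c ∧ W a b c ≤ a + b + c) ∧
    (∀ x : ℝ, 1 ≤ x → W 1 x 1 = x + 1 + e x) ∧
    (∀ x : ℝ, 0 < x → x ≤ 1 → W 1 x 1 = max 2 ((3 + x) / 2 + (1 + x) / 2 * e (2 / (1 + x)))) ∧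
    W 1 1 1 = 2 + e 1 := by
  obtain ⟨h1, h2, h3, h4, h5, h6⟩ := foldShadow_admissible hconv hanti hnn hcube hF
  have R := perspectiveWorld_realises hW h1 h2 h3 h4 h5 h6
  refine ⟨R.1, R.2.1, R.2.2.1, R.2.2.2.1, R.2.2.2.2.1, fun x hx => ?_, fun x hx hx1 => ?_, ?_⟩
  · rw [R.2.2.2.2.2 x (by linarith), F_far hF hx]
  · rw [R.2.2.2.2.2 x hx, F_near hnn hF hx1]
  · rw [R.2.2.2.2.2 1 one_pos, F_far hF le_rfl]; ring

end FoldShadow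

/-- ★ FAR-TAIL FREEDOM (existential form).  Every `e : [1,∞) → ℝ` that is convex, antitone, nonnegative and
cube-line coupled IS the far excess of a 3D-lawful functional: together with `omega_farExcess_free` /
`farExcess_free_of_laws`, the far tails of lawful functionals are EXACTLY the free class — the laws couple
the near side to the far tail only through the square (`ω_W = 2 + e(1)` and the slope `(1 − e(1))/3`). -/
theorem farTail_realisable {e : ℝ → ℝ} (hconv : ConvexOn ℝ (Ici 1) e) (hanti : AntitoneOn e (Ici 1))
    (hnn : ∀ x : ℝ, 1 ≤ x → 0 ≤ e x) (hcube : ∀ x : ℝ, 1 ≤ x → e 1 - e x ≤ (1 - e 1) / 3 * (x - 1)) :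
    ∃ W : ℝ → ℝ → ℝ → ℝ,
      (∀ a b c : ℝ, W a b c = W b a c ∧ W a b c = W a c b) ∧
      (∀ ν : ℝ, 0 < ν → ∀ a b c : ℝ, 0 < a → 0 < b → 0 < c →
        W (ν * a) (ν * b) (ν * c) = ν * W a b c) ∧
      (∀ a b c a' b' c' : ℝ, 0 < a → 0 < b → 0 < c → 0 < a' → 0 < b' → 0 < c' →
        W (a + a') (b + b') (c + c') ≤ W a b c + W a' b' c') ∧
      (∀ a b b' c : ℝ, 0 < a → 0 < b → b ≤ b' → 0 < c → W a b c ≤ W a b' c) ∧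
      (∀ a b c : ℝ, 0 < a → 0 < b → 0 < c →
        max (a + c) (max (a + b) (b + c)) ≤ W a b c ∧ W a b c ≤ a + b + c) ∧
      (∀ x : ℝ, 1 ≤ x → W 1 x 1 = x + 1 + e x) ∧ W 1 1 1 = 2 + e 1 := by
  let F : ℝ → ℝ := fun x => if 1 ≤ x then x + 1 + e x
    else max 2 ((3 + x) / 2 + (1 + x) / 2 * e (2 / (1 + x)))
  let W : ℝ → ℝ → ℝ → ℝ := fun a b c => max ((a + c) / 2 * F (2 * b / (a + c)))
    (max ((a + b) / 2 * F (2 * c / (a + b))) ((b + c) / 2 * F (2 * a / (b + c))))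
  have R := foldShadow_realises (F := F) (W := W) hconv hanti hnn hcube (fun _ => rfl) (fun _ _ _ => rfl)
  exact ⟨W, R.1, R.2.1, R.2.2.1, R.2.2.2.1, R.2.2.2.2.1, R.2.2.2.2.2.1, R.2.2.2.2.2.2.2⟩

end Summit.MatrixMultiplication.MatrixMultiplication.Theorems.FarEdgeDescentTailShadow
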